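import Summits.QuantumAdvantage.QuantumAdvantage.Theorems.HankelLiftHankelDiscrepancy

/-!
# Staircase (threshold-of-a-sum) discrepancy of the Liouville Hankel pattern

Route `route-QuantumAdvantage-HankelLift`.  Support of its one open item, the hypothesis-type crux
`HankelLift.BeyondRectangles` (stmt-QuantumAdvantage-18440: "no PPT predicts `λ(x+y+2)` noticeably
better than the best rectangle rule"), in the form of the UNCONDITIONAL layer-2 rung "MajMajRung" that
the route's two-layer plan files under the proved crux `HankelLift.HankelDiscrepancy`: restricted
classes of predictors provably fail on the lifted Liouville witness `F_n(x,y) = λ(x+y+2)`,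
`x, y ∈ [0, 2^n)`.

* `staircase_sum_le` — **dyadic chaining.**  If a real matrix `F` on `[N]²` satisfies the
  operator-type rectangle bound `|∑_{S×T} F| ≤ B·√(|S|·|T|)` for all `S, T`, then for all real
  `α, β` and all `P, Q ⊆ [N]` with `|Q| ≤ 2^j`,
  `|∑_{x ∈ P, y ∈ Q : β(y) ≤ α(x)} F(x,y)| ≤ B·(j+1)·√(|P|·|Q|)`.
  A STAIRCASE is a threshold of (row function) + (column function); split the columns at the median
  of `β`: the two off-diagonal blocks are a full rectangle and an empty set, the two diagonal blocks
  are staircases with half as many columns, and `√(|P₁||Q₁|) + √(|P₂||Q₂|) ≤ √(|P||Q|)` recombines.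
* `hankel_rectangle_bound`, `hankel_staircase_discrepancy` — for every `C`, for all large `n`, every
  `a b : [2^n] → ℝ` and `t : ℝ` give `|∑_{x,y : t ≤ a(x)+b(y)} λ(x+y+2)| ≤ 4^n / n^C`.  Rectangles
  `S × T` are the staircases `1_S(x) + 1_T(y) ≥ 2`, so this contains `HankelDiscrepancy`; the input
  is Davenport's uniform bound in the dyadic form `HankelLift.davenport_liouville_dyadic` through the
  Parseval lemma `HankelLift.rectangle_sum_le_of_symbol_bound` (the `B·√(|S||T|)` form is essential).

Consumer: `Theorems/HankelLiftBeyondRectanglesMajThr.lean` (the `MAJ ∘ THR` rung: no poly-size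
majority of arbitrary separable threshold gates computes `λ(x+y+2)`, via the discriminator lemma).
The staircase shape is the one Jukna 2012 §11.10 (proof of Thm 11.37, after Hajnal et al. 1993)
handles for `IP_n` by cutting into `N^{2/3}` squares; dyadic chaining loses only a factor `n + 1`.
Not here: anything about the hypothesis `BeyondRectangles` itself (open; these are unconditional
discrepancy bounds, the hypothesis is average-case hardness for all PPT).
-/

set_option linter.dupNamespace false -- D-0017: single-problem summit ⇒ `QuantumAdvantage.QuantumAdvantage` by design

noncomputable section

namespace Summit.QuantumAdvantage.QuantumAdvantage.Theorems.HankelLift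

open Finset Real Filter ArithmeticFunction
open Literature.NumberTheory.Sieve.Vinogradov (afExpSum)

/-! ## Dyadic chaining for staircases -/

/-- `√(ac) + √(bd) ≤ √((a+b)(c+d))` for nonnegative reals (Cauchy–Schwarz in `ℝ²`). [folklore] -/
theorem sqrt_mul_add_sqrt_mul_le {a b c d : ℝ} (ha : 0 ≤ a) (hb : 0 ≤ b) (hc : 0 ≤ c)
    (hd : 0 ≤ d) : Real.sqrt (a * c) + Real.sqrt (b * d) ≤ Real.sqrt ((a + b) * (c + d)) := by
  rw [Real.sqrt_mul ha, Real.sqrt_mul hb]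
  refine Real.le_sqrt_of_sq_le ?_
  have ha' := Real.sq_sqrt ha
  have hb' := Real.sq_sqrt hb
  have hc' := Real.sq_sqrt hc
  have hd' := Real.sq_sqrt hd
  nlinarith [sq_nonneg (Real.sqrt a * Real.sqrt d - Real.sqrt b * Real.sqrt c),
    Real.sqrt_nonneg a, Real.sqrt_nonneg b, Real.sqrt_nonneg c, Real.sqrt_nonneg d]

/-- **Initial segments**: a finite set `Q` with a real key `β` has, for every `k ≤ |Q|`, a subset of
size `k` whose keys are all `≤` the keys outside it (the `k` smallest, ties broken arbitrarily).
[folklore] -/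
theorem exists_initialSegment {ι : Type*} [DecidableEq ι] (Q : Finset ι) (β : ι → ℝ) (k : ℕ)
    (hk : k ≤ Q.card) :
    ∃ Q₁ ⊆ Q, Q₁.card = k ∧ ∀ y ∈ Q₁, ∀ y' ∈ Q, y' ∉ Q₁ → β y ≤ β y' := by
  induction k with
  | zero => exact ⟨∅, Finset.empty_subset _, rfl, by simp⟩
  | succ k ih =>
    obtain ⟨Q₁, hsub, hcard, hseg⟩ := ih (Nat.le_of_succ_le hk)
    have hne : (Q \ Q₁).Nonempty := by
      rw [← Finset.card_pos, Finset.card_sdiff_of_subset hsub]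
      omega
    obtain ⟨y₀, hy₀, hmin⟩ := Finset.exists_min_image (Q \ Q₁) β hne
    rw [Finset.mem_sdiff] at hy₀
    refine ⟨insert y₀ Q₁, Finset.insert_subset hy₀.1 hsub,
      by rw [Finset.card_insert_of_notMem hy₀.2, hcard], ?_⟩
    intro y hy y' hy' hy'not
    rw [Finset.mem_insert] at hy
    have hy'Q₁ : y' ∉ Q₁ := fun h => hy'not (Finset.mem_insert_of_mem h)
    rcases hy with rfl | hy
    · exact hmin y' (Finset.mem_sdiff.mpr ⟨hy', hy'Q₁⟩)
    · exact hseg y hy y' hy' hy'Q₁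

/-- **Staircase sums by dyadic chaining.**  Let `F` be a real matrix on `[N]²` with the rectangle
bound `|∑_{x∈S} ∑_{y∈T} F(x,y)| ≤ B·√(|S|·|T|)` for all `S, T` (e.g. `B` = an operator-norm bound).
Then for all real keys `α, β`, all `j`, and all `P, Q` with `|Q| ≤ 2^j`, the STAIRCASE sum satisfies
`|∑_{x∈P} ∑_{y∈Q} [β(y) ≤ α(x)]·F(x,y)| ≤ B·(j+1)·√(|P|·|Q|)`.
Induction on `j`: split `Q` into the `2^j` smallest keys `Q₁` and the rest `Q₂`, and `P` at the
largest key `β*` of `Q₁`; `P₂ × Q₁` (`α ≥ β*`) is a full rectangle, `P₁ × Q₂` is empty, the diagonal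
blocks are smaller staircases, and `√(|P₁||Q₁|) + √(|P₂||Q₂|) ≤ √(|P||Q|)`. [folklore] -/
theorem staircase_sum_le {N : ℕ} (F : Fin N → Fin N → ℝ) {B : ℝ} (hB : 0 ≤ B)
    (hF : ∀ S T : Finset (Fin N),
      |∑ x ∈ S, ∑ y ∈ T, F x y| ≤ B * Real.sqrt ((S.card : ℝ) * (T.card : ℝ)))
    (α β : Fin N → ℝ) (j : ℕ) :
    ∀ P Q : Finset (Fin N), Q.card ≤ 2 ^ j →
      |∑ x ∈ P, ∑ y ∈ Q, (if β y ≤ α x then F x y else 0)| ≤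
        B * ((j : ℝ) + 1) * Real.sqrt ((P.card : ℝ) * (Q.card : ℝ)) := by
  induction j with
  | zero =>
    intro P Q hQ
    rw [pow_zero] at hQ
    rcases Q.eq_empty_or_nonempty with hQe | hQne
    · subst hQe
      simp only [Finset.sum_empty, Finset.sum_const_zero, abs_zero]
      positivity
    · obtain ⟨y, rfl⟩ := Finset.card_eq_one.mp (le_antisymm hQ (Finset.card_pos.mpr hQne))
      have h := hF (P.filter fun x => β y ≤ α x) {y}
      simp only [Finset.sum_singleton, Finset.card_singleton, Nat.cast_one, mul_one,
        Nat.cast_zero, zero_add] at h ⊢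
      rw [Finset.sum_filter] at h
      refine h.trans ?_
      gcongr
      exact Finset.filter_subset _ _
  | succ j ih =>
    intro P Q hQ
    by_cases hsmall : Q.card ≤ 2 ^ j
    · refine (ih P Q hsmall).trans ?_
      have h0 : 0 ≤ Real.sqrt ((P.card : ℝ) * (Q.card : ℝ)) := Real.sqrt_nonneg _
      push_cast
      nlinarith [mul_nonneg hB h0]
    push Not at hsmall
    obtain ⟨Q₁, hQ₁Q, hQ₁card, hseg⟩ := exists_initialSegment Q β (2 ^ j) hsmall.le
    set Q₂ : Finset (Fin N) := Q \ Q₁ with hQ₂def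
    have hQ₁₂ : Q₂.card + Q₁.card = Q.card := Finset.card_sdiff_add_card_eq_card hQ₁Q
    have hQ₂card : Q₂.card ≤ 2 ^ j := by rw [pow_succ] at hQ; omega
    have hQ₁ne : Q₁.Nonempty := by rw [← Finset.card_pos, hQ₁card]; positivity
    -- the splitting key
    obtain ⟨y₀, hy₀Q₁, hy₀max⟩ := Finset.exists_max_image Q₁ β hQ₁ne
    set βs : ℝ := β y₀ with hβs
    have hlo : ∀ y ∈ Q₁, β y ≤ βs := hy₀max
    have hhi : ∀ y' ∈ Q₂, βs ≤ β y' := fun y' hy' =>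
      hseg y₀ hy₀Q₁ y' (Finset.mem_sdiff.mp hy').1 (Finset.mem_sdiff.mp hy').2
    set P₁ : Finset (Fin N) := P.filter fun x => α x < βs with hP₁def
    set P₂ : Finset (Fin N) := P.filter fun x => ¬ α x < βs with hP₂def
    have hP₁₂ : P₁.card + P₂.card = P.card := Finset.card_filter_add_card_filter_not _
    -- the four blocks
    set G : Fin N → Fin N → ℝ := fun x y => if β y ≤ α x then F x y else 0 with hGdef
    have hsplit : ∑ x ∈ P, ∑ y ∈ Q, G x y =
        (∑ x ∈ P₁, ∑ y ∈ Q₁, G x y + ∑ x ∈ P₂, ∑ y ∈ Q₁, G x y) +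
          (∑ x ∈ P₁, ∑ y ∈ Q₂, G x y + ∑ x ∈ P₂, ∑ y ∈ Q₂, G x y) := by
      have hQs : ∀ x, ∑ y ∈ Q, G x y = ∑ y ∈ Q₁, G x y + ∑ y ∈ Q₂, G x y := fun x => by
        rw [hQ₂def, ← Finset.sum_sdiff hQ₁Q, add_comm]
      rw [Finset.sum_congr rfl fun x _ => hQs x, Finset.sum_add_distrib,
        ← Finset.sum_filter_add_sum_filter_not P (fun x => α x < βs) fun x => ∑ y ∈ Q₁, G x y,
        ← Finset.sum_filter_add_sum_filter_not P (fun x => α x < βs) fun x => ∑ y ∈ Q₂, G x y]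
    -- `P₂ × Q₁` is full
    have hfull : ∑ x ∈ P₂, ∑ y ∈ Q₁, G x y = ∑ x ∈ P₂, ∑ y ∈ Q₁, F x y := by
      refine Finset.sum_congr rfl fun x hx => Finset.sum_congr rfl fun y hy => ?_
      have hx' : βs ≤ α x := not_lt.mp (Finset.mem_filter.mp hx).2
      exact if_pos ((hlo y hy).trans hx')
    -- `P₁ × Q₂` is empty
    have hempty : ∑ x ∈ P₁, ∑ y ∈ Q₂, G x y = 0 := by
      refine Finset.sum_eq_zero fun x hx => Finset.sum_eq_zero fun y hy => ?_
      have hx' : α x < βs := (Finset.mem_filter.mp hx).2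
      exact if_neg (not_le.mpr (hx'.trans_le (hhi y hy)))
    -- bounds for the four blocks
    have hA := ih P₁ Q₁ hQ₁card.le
    have hD := ih P₂ Q₂ hQ₂card
    have hBk : |∑ x ∈ P₂, ∑ y ∈ Q₁, F x y| ≤ B * Real.sqrt ((P.card : ℝ) * (Q.card : ℝ)) := by
      refine (hF P₂ Q₁).trans ?_
      gcongr
      · exact Finset.filter_subset _ _
    have hsq : Real.sqrt ((P₁.card : ℝ) * (Q₁.card : ℝ)) + Real.sqrt ((P₂.card : ℝ) * (Q₂.card : ℝ))
        ≤ Real.sqrt ((P.card : ℝ) * (Q.card : ℝ)) := by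
      have h := sqrt_mul_add_sqrt_mul_le (a := (P₁.card : ℝ)) (b := (P₂.card : ℝ))
        (c := (Q₁.card : ℝ)) (d := (Q₂.card : ℝ)) (by positivity) (by positivity) (by positivity)
        (by positivity)
      have hP : (P₁.card : ℝ) + (P₂.card : ℝ) = P.card := by exact_mod_cast hP₁₂
      have hQ' : (Q₁.card : ℝ) + (Q₂.card : ℝ) = Q.card := by rw [add_comm]; exact_mod_cast hQ₁₂
      rwa [hP, hQ'] at h
    have hB1 : 0 ≤ B * ((j : ℝ) + 1) := by positivity
    calc |∑ x ∈ P, ∑ y ∈ Q, G x y|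
        = |∑ x ∈ P₁, ∑ y ∈ Q₁, G x y + ∑ x ∈ P₂, ∑ y ∈ Q₁, F x y +
            ∑ x ∈ P₂, ∑ y ∈ Q₂, G x y| := by rw [hsplit, hfull, hempty, zero_add, add_assoc]
      _ ≤ |∑ x ∈ P₁, ∑ y ∈ Q₁, G x y| + |∑ x ∈ P₂, ∑ y ∈ Q₁, F x y| +
            |∑ x ∈ P₂, ∑ y ∈ Q₂, G x y| := abs_add_three _ _ _
      _ ≤ B * ((j : ℝ) + 1) * Real.sqrt ((P₁.card : ℝ) * (Q₁.card : ℝ)) +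
            B * Real.sqrt ((P.card : ℝ) * (Q.card : ℝ)) +
            B * ((j : ℝ) + 1) * Real.sqrt ((P₂.card : ℝ) * (Q₂.card : ℝ)) := add_le_add_three hA hBk hD
      _ = B * ((j : ℝ) + 1) * (Real.sqrt ((P₁.card : ℝ) * (Q₁.card : ℝ)) +
            Real.sqrt ((P₂.card : ℝ) * (Q₂.card : ℝ))) + B * Real.sqrt ((P.card : ℝ) * (Q.card : ℝ)) := by
          ring
      _ ≤ B * ((j : ℝ) + 1) * Real.sqrt ((P.card : ℝ) * (Q.card : ℝ)) +
            B * Real.sqrt ((P.card : ℝ) * (Q.card : ℝ)) := by gcongr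
      _ = B * (((j + 1 : ℕ) : ℝ) + 1) * Real.sqrt ((P.card : ℝ) * (Q.card : ℝ)) := by
          push_cast; ring

/-! ## The staircase discrepancy of `λ(x+y+2)` -/

/-- **Operator form of `HankelDiscrepancy`**: for every `C`, for all large `n`, every rectangle
`S × T ⊆ [2^n]²` has `|∑_{x∈S} ∑_{y∈T} λ(x+y+2)| ≤ (2^n/n^C)·√(|S|·|T|)` — Davenport's bound
`HankelLift.davenport_liouville_dyadic` fed into the Parseval lemma
`HankelLift.rectangle_sum_le_of_symbol_bound` (shift `2`, no wrap-around).
[cite: MontgomeryVaughan2007, §11.3 Exercise 13(f) p. 384] -/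
theorem hankel_rectangle_bound (C : ℕ) : ∀ᶠ n : ℕ in atTop, ∀ S T : Finset (Fin (2 ^ n)),
    |∑ x ∈ S, ∑ y ∈ T, ((liouville (x.val + y.val + 2) : ℤ) : ℝ)| ≤
      (2 : ℝ) ^ n / (n : ℝ) ^ C * Real.sqrt ((S.card : ℝ) * (T.card : ℝ)) := by
  filter_upwards [davenport_liouville_dyadic C] with n hDn S T
  have h := rectangle_sum_le_of_symbol_bound (2 ^ n) 2 (by norm_num)
    (⇑(liouville : ArithmeticFunction ℝ)) _ (fun θ => by simpa [two_mul, pow_succ, mul_comm] using hDn θ) S T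
  simpa only [intCoe_apply] using h

/-- The staircase discrepancy with its chaining factor: for every `C`, for all large `n`, all real
`a, b : [2^n] → ℝ` and `t : ℝ`,
`|∑_{x,y : t ≤ a(x)+b(y)} λ(x+y+2)| ≤ (n+1)·4^n/n^C` (`staircase_sum_le` with `2^n` columns,
`j = n`, keys `α = a`, `β = t − b`). [folklore] -/
theorem hankel_staircase_sum_le (C : ℕ) : ∀ᶠ n : ℕ in atTop, ∀ (a b : Fin (2 ^ n) → ℝ) (t : ℝ),
    |∑ x : Fin (2 ^ n), ∑ y : Fin (2 ^ n),
        (if t ≤ a x + b y then ((liouville (x.val + y.val + 2) : ℤ) : ℝ) else 0)| ≤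
      ((n : ℝ) + 1) * (4 : ℝ) ^ n / (n : ℝ) ^ C := by
  filter_upwards [hankel_rectangle_bound C] with n hn a b t
  have key := staircase_sum_le (fun x y : Fin (2 ^ n) => ((liouville (x.val + y.val + 2) : ℤ) : ℝ))
    (B := (2 : ℝ) ^ n / (n : ℝ) ^ C) (by positivity) hn a (fun y => t - b y) n univ univ (by simp)
  simp only [sub_le_iff_le_add, Finset.card_univ, Fintype.card_fin] at key
  refine key.trans (le_of_eq ?_)
  have h4 : (4 : ℝ) ^ n = (2 : ℝ) ^ n * (2 : ℝ) ^ n := by rw [← mul_pow]; norm_num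
  push_cast
  rw [Real.sqrt_mul_self (by positivity), h4]
  ring

/-- **Staircase discrepancy of the Liouville Hankel pattern.**  For every `C`, for all large `n`,
every threshold-of-a-sum region `{(x,y) ∈ [2^n]² : t ≤ a(x) + b(y)}` (`a, b` ARBITRARY real
functions, `t` real) satisfies `|∑_{t ≤ a(x)+b(y)} λ(x+y+2)| ≤ 4^n / n^C`.  Contains
`HankelDiscrepancy` (rectangles `S × T` = staircases `1_S(x) + 1_T(y) ≥ 2`) and covers every
real-weight linear threshold gate of the `2n` bits of `(x, y)`. From `hankel_staircase_sum_le` at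
`C + 2` (`n + 1 ≤ n²` for `n ≥ 2`). [folklore] -/
theorem hankel_staircase_discrepancy (C : ℕ) : ∀ᶠ n : ℕ in atTop,
    ∀ (a b : Fin (2 ^ n) → ℝ) (t : ℝ),
      |∑ x : Fin (2 ^ n), ∑ y : Fin (2 ^ n),
          (if t ≤ a x + b y then ((liouville (x.val + y.val + 2) : ℤ) : ℝ) else 0)| ≤
        (4 : ℝ) ^ n / (n : ℝ) ^ C := by
  filter_upwards [hankel_staircase_sum_le (C + 2), eventually_ge_atTop 2] with n hn hn2 a b t
  refine (hn a b t).trans ?_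
  have hn2' : (2 : ℝ) ≤ n := by exact_mod_cast hn2
  have hn0 : (0 : ℝ) < n := by linarith
  rw [div_le_div_iff₀ (by positivity) (by positivity), pow_add]
  have h4 : (0 : ℝ) < (4 : ℝ) ^ n := by positivity
  have hC : (0 : ℝ) < (n : ℝ) ^ C := by positivity
  nlinarith [mul_pos h4 hC, mul_le_mul_of_nonneg_left hn2' hn0.le]

end Summit.QuantumAdvantage.QuantumAdvantage.Theorems.HankelLift
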